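/-
Copyright (c) 2026 the pub-hodgecm-mathlib formalisation cell (harness21).  Prover seat hodgecm-mathlib-F0P2-p10 (g2), Track B «K2-LIT»,
#184♮ = hLiu418 = `stmt-HodgeConjecture-24832`; socket #41, KIND 1, organ (K1b-W), seam (KW1-e) PART 3b = (e3-glob): THE TRANSLATED CORNER FAMILY IS FACTORIZABLE OFF `T' ⊇ T ∪ T(g)`.
THEOREMS ONLY (no `def`, no `instance`, no notation, no named-fact hypothesis, no `sorry`).
-/
import Summits.HodgeConjecture.HodgeConjecture.Theorems.K2LiuKindOneLineLocalPullback      -- ★ (e3-loc) p862847: `lambdaLoc_evalPlace_blkD_inr_mul`, `evalPlace_finPart_blkD_inr_mul`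
import Literature.NumberTheory.K2Lit.LocalDoublingUnramifiedHecke                         -- ★ #31s `IsFactorizableOff`
import HarnessLib

/-!
# Crux `HLiu418`, socket #41, KIND 1 ∕ (K1b-W), seam (KW1-e) PART 3b — `K2LiuKindOneLineFactorizable`: `f` FACTORIZABLE OFF `T` ⇒ `y ↦ f_s(blkD(1,y)·g)` FACTORIZABLE OFF
# `T'` (any finite `T' ⊇ T` off which `g_v ∈ K_v`, `χ` is unramified and `U(J^𝔻_{V₂})(L⁺_v) = P_Δ K` holds), with spherical components `Λ^{(V₂)}_{s + n₁∕2, v}`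

Cell `hodgecm-mathlib`, crux item hLiu418 = `stmt-HodgeConjecture-24832` (route of record `HCCMUnconditional`); squad K2 ∕ K2Liu, road `K2_Liu`, socket #41, KIND 1,
K1-b♮ line term; (K1b-W) line lead K2Liu-p14 (g4) (LINE WORD #1 (1): exceptional set `T(g) := T₀ ∪ {v : g_v ∉ K_v}`, `T`-components `y ↦ f_{s,v}(blkD_v(1,y)·g_v)`,
spherical `Λ⁽¹⁾_{s+½,v}` off `T(g)`), K1 desk F0P2-p11 (g2) (22:51:03Z: «THE ONE SEAM LEFT FOR K1-b♮ = `IsFactorizableOff` of the pulled-back family»).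
THEOREMS ONLY; lane `--supports stmt-HodgeConjecture-24832 --as helper` (count-neutral).
* §1 `archPart_blkD_inr_congr` (the archimedean slot of the chart depends on `y_∞` only, ★ (e2) `coe_archPart_blkD_inr`), `archPart_blkD_inr_archToAdelic`
  (`(blkD(1, (a,1)))_∞ = (blkD(1,y))_∞` for `a = y_∞`, ★ `archPart_archToAdelic`).
* §2 `finite_mulSupport_lambdaLoc_total` + `finprod_notMem_eq_prod_mul_finprod_notMem` — the off-`T` product splits as `∏_{T'∖T} · ∏ᶠ_{∉T'}` (Mathlib `finprod_mem_union'`).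
* §3 **`isFactorizableOff_cornerTranslate`** — `IsFactorizableOff⁽ⱽ⁾ T χ f fT →` (for `T ⊆ T'`, `g_v ∈ K_v`, `χ` unramified above `v`, and Siegel–integral decompositions in
  `U(J^𝔻_{V₂})(L⁺_v)` for `v ∉ T'` — ★ `exists_isSiegelIntDecomp` off the datum's bad places) `IsFactorizableOff⁽ᴮ⁾ T' χ (fun s y => f s (blkD (1,y) · g)) fT'` with the EXPLICIT
  `fT' s (a, (y_v)_{v∈T'}) := fT s ((blkD(1,(a,1)) · g)_∞, (B_v(y_v) · g_v)_{v∈T}) · ∏_{v ∈ T'∖T} Λ^{(V)}_{s,v}(B_v(y_v) · g_v)` and — by ★ #31s's definition at the datum `V₂` with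
  parameter `s + n₁∕2`?  NO: `IsFactorizableOff` fixes the spherical parameter to be the family parameter, so the conclusion is stated for the REPARAMETRISED family
  `Φ s' y := f (s' − n₁∕2) (blkD (1,y) · g)` whose spherical components are `Λ^{(V₂)}_{s',v}` on the nose (★ (e3-loc) `lambdaLoc_evalPlace_blkD_inr_mul` at `s = s' − n₁∕2`).
[Liu2011, §2B p. 862], [GelbartPiatetskishapiroRallis1987, Part A §1, §6], [Kudla1994, §2–§3], [KudlaRallis1994, §2], [BorelJacquet1979, §4.1].
HONEST LABEL.  Count-neutral helper, closes no socket: `HC_CM` is proved only modulo the 7 printed citations (2 remaining named inputs: hLiu418 =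
`stmt-HodgeConjecture-24832`, h413 = `stmt-HodgeConjecture-24833`) until rung 0 closes.

## References
* [Liu2011] Y. Liu, *Arithmetic theta lifting and L-derivatives for unitary groups, I*, Algebra & Number Theory 5 (2011), §2B p. 862.
* [GelbartPiatetskishapiroRallis1987] S. Gelbart, I. Piatetski-Shapiro, S. Rallis, LNM 1254 (1987), Part A §1, §6.
* [Kudla1994] S. S. Kudla, *Splitting metaplectic covers of dual reductive pairs*, Israel J. Math. 87 (1994), §2–§3.
* [KudlaRallis1994] S. S. Kudla, S. Rallis, Ann. of Math. 140 (1994), §2.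
* [BorelJacquet1979] A. Borel, H. Jacquet, Proc. Symp. Pure Math. 33.1 (1979), §4.1.
-/

set_option autoImplicit false
set_option linter.dupNamespace false -- the mandated namespace repeats `HodgeConjecture.HodgeConjecture`

noncomputable section

open scoped Classical
open scoped Matrix
open NumberField IsDedekindDomain
open Literature.NumberTheory.Automorphic Literature.NumberTheory.GaloisRepresentations
open Literature.NumberTheory.GelbartRogawski1991 Literature.NumberTheory.GelbartRogawski1991.GRConstruction
open Literature.NumberTheory.GelbartRogawski1991.UnitaryDualPair
open Literature.NumberTheory.K2Lit.SiegelDoubled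
open Summit.HodgeConjecture.HodgeConjecture.Cruxes.HLiu418.K2LiuBlockDiagPlaces (coe_archPart_blkD_inr)
open Summit.HodgeConjecture.HodgeConjecture.Cruxes.HLiu418.K2LiuKindOneLineLocalPullback

namespace Summit.HodgeConjecture.HodgeConjecture.Cruxes.HLiu418.K2LiuKindOneLineFactorizable

variable (L : Type) [Field L] [NumberField L] [IsCMField L]
variable {N₁ N₂ M n n₁ n₂ : ℕ} (eV : Fin (N₁ + N₂) × Fin M ≃ Fin n) (eA : Fin N₁ × Fin M ≃ Fin n₁) (eB : Fin N₂ × Fin M ≃ Fin n₂)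
  (dA : Fin N₁ → L) (hdA : ∀ i, IsCMField.complexConj L (dA i) = dA i)
  (dB : Fin N₂ → L) (hdB : ∀ i, IsCMField.complexConj L (dB i) = dB i)
  (dV : Fin (N₁ + N₂) → L) (hdV : ∀ i, IsCMField.complexConj L (dV i) = dV i)
  (hVA : ∀ i, dV (Fin.castAdd N₂ i) = dA i) (hVB : ∀ j, dV (Fin.natAdd N₁ j) = dB j)
  (dW : Fin M → L) (hdW : ∀ i, IsCMField.complexConj L (dW i) = dW i)

/-! ## §1 The archimedean slot of the chart depends on `y_∞` only -/

/-- `(blkD (1,y))_∞ = (blkD (1,y'))_∞` as soon as `y_∞ = y'_∞` (★ (e2) `coe_archPart_blkD_inr`: both are `σ⁻¹[diag(1, y_∞)]`). [cite: Kudla1994, §2] [cite: BorelJacquet1979, §4.1] -/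
theorem archPart_blkD_inr_congr {y y' : HA L eB dB hdB dW hdW}
    (h : UnitaryGroup.archPart (Fp L) L (IsCMField.complexConj L) (n₂ + n₂) (hermD L eB dB hdB dW hdW) y = UnitaryGroup.archPart (Fp L) L (IsCMField.complexConj L) (n₂ + n₂) (hermD L eB dB hdB dW hdW) y') :
    UnitaryGroup.archPart (Fp L) L (IsCMField.complexConj L) (n + n) (hermD L eV dV hdV dW hdW) (blkD L eV eA eB dA hdA dB hdB dV hdV hVA hVB dW hdW (1, y)) = UnitaryGroup.archPart (Fp L) L (IsCMField.complexConj L) (n + n) (hermD L eV dV hdV dW hdW) (blkD L eV eA eB dA hdA dB hdB dV hdV hVA hVB dW hdW (1, y')) := by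
  refine Subtype.ext ?_
  rw [coe_archPart_blkD_inr, coe_archPart_blkD_inr, h]

/-- `(blkD (1, (a, 1)))_∞ = (blkD (1, y))_∞` for `a = y_∞`, `(a,1) := ★ archToAdelic a` (★ `archPart_archToAdelic`). [cite: Kudla1994, §2] [cite: BorelJacquet1979, §4.1] -/
theorem archPart_blkD_inr_archToAdelic (y : HA L eB dB hdB dW hdW) :
    UnitaryGroup.archPart (Fp L) L (IsCMField.complexConj L) (n + n) (hermD L eV dV hdV dW hdW) (blkD L eV eA eB dA hdA dB hdB dV hdV hVA hVB dW hdW (1, (UnitaryGroup.archToAdelic (Fp L) L (IsCMField.complexConj L) (n₂ + n₂) (hermD L eB dB hdB dW hdW) (UnitaryGroup.archPart (Fp L) L (IsCMField.complexConj L) (n₂ + n₂) (hermD L eB dB hdB dW hdW) y) : HA L eB dB hdB dW hdW))) =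
      UnitaryGroup.archPart (Fp L) L (IsCMField.complexConj L) (n + n) (hermD L eV dV hdV dW hdW) (blkD L eV eA eB dA hdA dB hdB dV hdV hVA hVB dW hdW (1, y)) :=
  archPart_blkD_inr_congr L eV eA eB dA hdA dB hdB dV hdV hVA hVB dW hdW (UnitaryGroup.archPart_archToAdelic (Fp L) L (IsCMField.complexConj L) (n₂ + n₂) (hermD L eB dB hdB dW hdW) _)

/-! ## §2 Finite support and the splitting of the off-`T` product -/

/-- the TOTAL function `v ↦ Λ_{s,v}(h_v)` is finitely supported for `χ` unramified almost everywhere (`h_v ∈ K_v` and `χ` unramified for almost all `v`, where `Λ_{s,v} = 1`;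
★ `eventually_evalPlace_mem_localInt`, ★ `finite_setOf_exists_not_isUnramifiedAt`, ★ `lambdaLoc_of_mem_localInt`). [cite: Liu2011, §2B p. 862] [cite: BorelJacquet1979, §4.1] -/
theorem finite_mulSupport_lambdaLoc_total (χ : HeckeCharacter L) (hχ : ∀ᶠ w : HeightOneSpectrum (𝓞 L) in Filter.cofinite, χ.IsUnramifiedAt w) (s : ℂ)
    (h : HA L eV dV hdV dW hdW) :
    (Function.mulSupport fun v : HeightOneSpectrum (𝓞 (Fp L)) =>
      LambdaLoc L eV dV hdV dW hdW v χ s (UnitaryGroup.evalPlace (Fp L) L (IsCMField.complexConj L) (n + n) (hermD L eV dV hdV dW hdW) v (UnitaryGroup.finPart (Fp L) L (IsCMField.complexConj L) (n + n) (hermD L eV dV hdV dW hdW) h))).Finite := by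
  have h1 : {v : HeightOneSpectrum (𝓞 (Fp L)) | ¬ UnitaryGroup.evalPlace (Fp L) L (IsCMField.complexConj L) (n + n) (hermD L eV dV hdV dW hdW) v (UnitaryGroup.finPart (Fp L) L (IsCMField.complexConj L) (n + n) (hermD L eV dV hdV dW hdW) h) ∈ UnitaryGroup.localInt L (IsCMField.complexConj L) (n + n) (hermD L eV dV hdV dW hdW) v}.Finite :=
    Filter.eventually_cofinite.1 (UnitaryGroup.eventually_evalPlace_mem_localInt (Fp L) L (IsCMField.complexConj L) (n + n) (hermD L eV dV hdV dW hdW) _)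
  have h2 := finite_setOf_exists_not_isUnramifiedAt L χ hχ
  refine (h1.union h2).subset ?_
  intro v hv
  by_contra hcon
  simp only [Set.mem_union, Set.mem_setOf_eq, not_or, not_not, not_exists] at hcon
  exact hv (lambdaLoc_of_mem_localInt L eV dV hdV dW hdW v χ s (fun w => hcon.2 w) hcon.1)

omit [NumberField L] [IsCMField L] in
/-- splitting a finitely supported product off `T` at a larger finite set `T' ⊇ T`: `∏ᶠ_{v ∉ T} F v = (∏_{v ∈ T'∖T} F v) · ∏ᶠ_{v ∉ T'} F v` (Mathlib `finprod_mem_union'`,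
`finprod_mem_coe_finset`). [cite: Liu2011, §2B p. 862] -/
theorem finprod_notMem_eq_prod_mul_finprod_notMem (F : HeightOneSpectrum (𝓞 (Fp L)) → ℂ) (hF : (Function.mulSupport F).Finite)
    {T T' : Finset (HeightOneSpectrum (𝓞 (Fp L)))} (hTT' : T ⊆ T') :
    ∏ᶠ v : {v : HeightOneSpectrum (𝓞 (Fp L)) // v ∉ T}, F v.1 = (∏ v ∈ T' \ T, F v) * ∏ᶠ v : {v : HeightOneSpectrum (𝓞 (Fp L)) // v ∉ T'}, F v.1 := by
  rw [finprod_subtype_eq_finprod_cond (f := F) (p := fun v => v ∉ T), finprod_subtype_eq_finprod_cond (f := F) (p := fun v => v ∉ T')]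
  have hset : ((↑T : Set (HeightOneSpectrum (𝓞 (Fp L))))ᶜ) = (↑(T' \ T) : Set _) ∪ (↑T' : Set _)ᶜ := by
    ext v
    simp only [Set.mem_compl_iff, Finset.mem_coe, Set.mem_union, Finset.mem_sdiff]
    constructor
    · intro hv
      by_cases hv' : v ∈ T'
      · exact Or.inl ⟨hv', hv⟩
      · exact Or.inr hv'
    · rintro (⟨-, hv⟩ | hv)
      · exact hv
      · exact fun hvT => hv (hTT' hvT)
  have hdisj : Disjoint (↑(T' \ T) : Set (HeightOneSpectrum (𝓞 (Fp L)))) (↑T' : Set _)ᶜ := by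
    rw [Set.disjoint_iff]
    rintro v ⟨hv1, hv2⟩
    exact hv2 (Finset.mem_sdiff.1 (Finset.mem_coe.1 hv1)).1
  show ∏ᶠ v ∈ ((↑T : Set (HeightOneSpectrum (𝓞 (Fp L))))ᶜ), F v = (∏ v ∈ T' \ T, F v) * ∏ᶠ v ∈ ((↑T' : Set (HeightOneSpectrum (𝓞 (Fp L))))ᶜ), F v
  rw [hset, finprod_mem_union' hdisj (hF.subset Set.inter_subset_right) (hF.subset Set.inter_subset_right), finprod_mem_coe_finset]

/-! ## §3 The factorizability transport -/

set_option maxHeartbeats 1600000 in -- MEASURED: the `↥HA`-vs-`.Adelic` defeq at two datum sizes inside the component identities (`isDefEq` times out at 200000 while elaborating `hX`)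
/-- **THE TRANSLATED CORNER FAMILY IS FACTORIZABLE.**  Let `f` be factorizable off `T` through `fT` (★ #31s `IsFactorizableOff` at the datum `V`), `g ∈ U(J^𝔻_V)(𝔸)`, and `T' ⊇ T`
a finite set of places off which `g_v ∈ K_v`, `χ` is unramified above `v`, and every element of `U(J^𝔻_{V₂})(L⁺_v)` has a Siegel–integral decomposition (★ `exists_isSiegelIntDecomp` off the
datum's bad places); let `χ` be unramified almost everywhere.  Then the REPARAMETRISED translated corner family `Φ s' y := f (s' − n₁∕2) (blkD (1,y) · g)` is factorizable off `T'` at the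
datum `V₂` through the explicit `fT'` below, i.e. `Φ_{s'}(y) = fT'_{s'}(y_∞, (y_v)_{v∈T'}) · ∏ᶠ_{v∉T'} Λ^{(V₂)}_{s',v}(y_v)` — spherical components `Λ^{(V₂)}_{s',v}` ON THE NOSE
(★ (e3-loc) `lambdaLoc_evalPlace_blkD_inr_mul`: `Λ^{(V)}_{s'−n₁∕2,v}((blkD(1,y)·g)_v) = Λ^{(V₂)}_{s',v}(y_v)`), the `T'`-components riding inside `fT'` (line lead WORD #1 (1): «`g` rides
inside `fT'`»). [cite: Liu2011, §2B p. 862] [cite: GelbartPiatetskishapiroRallis1987, Part A §6] [cite: Kudla1994, §2–§3] [cite: KudlaRallis1994, §2] -/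
theorem isFactorizableOff_cornerTranslate {T T' : Finset (HeightOneSpectrum (𝓞 (Fp L)))} (hTT' : T ⊆ T') {χ : HeckeCharacter L}
    (hχ : ∀ᶠ w : HeightOneSpectrum (𝓞 L) in Filter.cofinite, χ.IsUnramifiedAt w)
    (hχT : ∀ v ∉ T', ∀ w : UnitaryGroup.PlacesOver L v, χ.IsUnramifiedAt w.1)
    {f : ℂ → HA L eV dV hdV dW hdW → ℂ}
    {fT : ℂ → UnitaryGroup.arch (Fp L) L (IsCMField.complexConj L) (n + n) (hermD L eV dV hdV dW hdW) × (Π v : ↥T, UnitaryGroup.localPi L (IsCMField.complexConj L) (n + n) (hermD L eV dV hdV dW hdW) v.1) → ℂ}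
    (hf : IsFactorizableOff L eV dV hdV dW hdW T χ f fT) {g : HA L eV dV hdV dW hdW}
    (hg : ∀ v ∉ T', UnitaryGroup.evalPlace (Fp L) L (IsCMField.complexConj L) (n + n) (hermD L eV dV hdV dW hdW) v (UnitaryGroup.finPart (Fp L) L (IsCMField.complexConj L) (n + n) (hermD L eV dV hdV dW hdW) g) ∈ UnitaryGroup.localInt L (IsCMField.complexConj L) (n + n) (hermD L eV dV hdV dW hdW) v)
    (hIw : ∀ v ∉ T', ∀ u : UnitaryGroup.localPi L (IsCMField.complexConj L) (n₂ + n₂) (hermD L eB dB hdB dW hdW) v, ∃ pk, IsSiegelIntDecomp L eB dB hdB dW hdW v u pk) :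
    IsFactorizableOff L eB dB hdB dW hdW T' χ (fun s' y => f (s' - (n₁ : ℂ) / 2) (blkD L eV eA eB dA hdA dB hdB dV hdV hVA hVB dW hdW (1, y) * g))
      (fun s' q =>
        fT (s' - (n₁ : ℂ) / 2) (UnitaryGroup.archPart (Fp L) L (IsCMField.complexConj L) (n + n) (hermD L eV dV hdV dW hdW) (blkD L eV eA eB dA hdA dB hdB dV hdV hVA hVB dW hdW (1, (UnitaryGroup.archToAdelic (Fp L) L (IsCMField.complexConj L) (n₂ + n₂) (hermD L eB dB hdB dW hdW) q.1 : HA L eB dB hdB dW hdW)) * g),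
            fun v : ↥T => UnitaryGroup.evalPlace (Fp L) L (IsCMField.complexConj L) (n + n) (hermD L eV dV hdV dW hdW) v.1 (UnitaryGroup.finPart (Fp L) L (IsCMField.complexConj L) (n + n) (hermD L eV dV hdV dW hdW) (blkD L eV eA eB dA hdA dB hdB dV hdV hVA hVB dW hdW (1, locToAdelic L eB dB hdB dW hdW v.1 (q.2 ⟨v.1, hTT' v.2⟩)))) *
              UnitaryGroup.evalPlace (Fp L) L (IsCMField.complexConj L) (n + n) (hermD L eV dV hdV dW hdW) v.1 (UnitaryGroup.finPart (Fp L) L (IsCMField.complexConj L) (n + n) (hermD L eV dV hdV dW hdW) g)) *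
          ∏ v ∈ T' \ T, LambdaLoc L eV dV hdV dW hdW v χ (s' - (n₁ : ℂ) / 2)
            (if hv : v ∈ T' then UnitaryGroup.evalPlace (Fp L) L (IsCMField.complexConj L) (n + n) (hermD L eV dV hdV dW hdW) v (UnitaryGroup.finPart (Fp L) L (IsCMField.complexConj L) (n + n) (hermD L eV dV hdV dW hdW) (blkD L eV eA eB dA hdA dB hdB dV hdV hVA hVB dW hdW (1, locToAdelic L eB dB hdB dW hdW v (q.2 ⟨v, hv⟩)))) * UnitaryGroup.evalPlace (Fp L) L (IsCMField.complexConj L) (n + n) (hermD L eV dV hdV dW hdW) v (UnitaryGroup.finPart (Fp L) L (IsCMField.complexConj L) (n + n) (hermD L eV dV hdV dW hdW) g) else 1)) := by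
  intro s' y
  -- the `v`-components of `X := blkD (1,y) · g`
  have hX : ∀ v : HeightOneSpectrum (𝓞 (Fp L)), UnitaryGroup.evalPlace (Fp L) L (IsCMField.complexConj L) (n + n) (hermD L eV dV hdV dW hdW) v (UnitaryGroup.finPart (Fp L) L (IsCMField.complexConj L) (n + n) (hermD L eV dV hdV dW hdW) (blkD L eV eA eB dA hdA dB hdB dV hdV hVA hVB dW hdW (1, y) * g)) =
      UnitaryGroup.evalPlace (Fp L) L (IsCMField.complexConj L) (n + n) (hermD L eV dV hdV dW hdW) v (UnitaryGroup.finPart (Fp L) L (IsCMField.complexConj L) (n + n) (hermD L eV dV hdV dW hdW) (blkD L eV eA eB dA hdA dB hdB dV hdV hVA hVB dW hdW (1, locToAdelic L eB dB hdB dW hdW v (UnitaryGroup.evalPlace (Fp L) L (IsCMField.complexConj L) (n₂ + n₂) (hermD L eB dB hdB dW hdW) v (UnitaryGroup.finPart (Fp L) L (IsCMField.complexConj L) (n₂ + n₂) (hermD L eB dB hdB dW hdW) y))))) * UnitaryGroup.evalPlace (Fp L) L (IsCMField.complexConj L) (n + n) (hermD L eV dV hdV dW hdW) v (UnitaryGroup.finPart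 (Fp L) L (IsCMField.complexConj L) (n + n) (hermD L eV dV hdV dW hdW) g) :=
    fun v => evalPlace_finPart_blkD_inr_mul L eV eA eB dA hdA dB hdB dV hdV hVA hVB dW hdW v y g
  -- the archimedean slot
  have harch : UnitaryGroup.archPart (Fp L) L (IsCMField.complexConj L) (n + n) (hermD L eV dV hdV dW hdW) (blkD L eV eA eB dA hdA dB hdB dV hdV hVA hVB dW hdW (1, y) * g) =
      UnitaryGroup.archPart (Fp L) L (IsCMField.complexConj L) (n + n) (hermD L eV dV hdV dW hdW) (blkD L eV eA eB dA hdA dB hdB dV hdV hVA hVB dW hdW (1, (UnitaryGroup.archToAdelic (Fp L) L (IsCMField.complexConj L) (n₂ + n₂) (hermD L eB dB hdB dW hdW) (UnitaryGroup.archPart (Fp L) L (IsCMField.complexConj L) (n₂ + n₂) (hermD L eB dB hdB dW hdW) y) : HA L eB dB hdB dW hdW)) * g) := by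
    have hm1 : UnitaryGroup.archPart (Fp L) L (IsCMField.complexConj L) (n + n) (hermD L eV dV hdV dW hdW) (blkD L eV eA eB dA hdA dB hdB dV hdV hVA hVB dW hdW (1, y) * g) = UnitaryGroup.archPart (Fp L) L (IsCMField.complexConj L) (n + n) (hermD L eV dV hdV dW hdW) (blkD L eV eA eB dA hdA dB hdB dV hdV hVA hVB dW hdW (1, y)) * UnitaryGroup.archPart (Fp L) L (IsCMField.complexConj L) (n + n) (hermD L eV dV hdV dW hdW) g := map_mul _ _ _
    have hm2 : UnitaryGroup.archPart (Fp L) L (IsCMField.complexConj L) (n + n) (hermD L eV dV hdV dW hdW) (blkD L eV eA eB dA hdA dB hdB dV hdV hVA hVB dW hdW (1, (UnitaryGroup.archToAdelic (Fp L) L (IsCMField.complexConj L) (n₂ + n₂) (hermD L eB dB hdB dW hdW) (UnitaryGroup.archPart (Fp L) L (IsCMField.complexConj L) (n₂ + n₂) (hermD L eB dB hdB dW hdW) y) : HA L eB dB hdB dW hdW)) * g) =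
        UnitaryGroup.archPart (Fp L) L (IsCMField.complexConj L) (n + n) (hermD L eV dV hdV dW hdW) (blkD L eV eA eB dA hdA dB hdB dV hdV hVA hVB dW hdW (1, (UnitaryGroup.archToAdelic (Fp L) L (IsCMField.complexConj L) (n₂ + n₂) (hermD L eB dB hdB dW hdW) (UnitaryGroup.archPart (Fp L) L (IsCMField.complexConj L) (n₂ + n₂) (hermD L eB dB hdB dW hdW) y) : HA L eB dB hdB dW hdW))) * UnitaryGroup.archPart (Fp L) L (IsCMField.complexConj L) (n + n) (hermD L eV dV hdV dW hdW) g := map_mul _ _ _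
    rw [hm1, hm2, archPart_blkD_inr_archToAdelic]
  -- the off-`T` product splits at `T'`
  have hsplit := finprod_notMem_eq_prod_mul_finprod_notMem L
    (fun v => LambdaLoc L eV dV hdV dW hdW v χ (s' - (n₁ : ℂ) / 2) (UnitaryGroup.evalPlace (Fp L) L (IsCMField.complexConj L) (n + n) (hermD L eV dV hdV dW hdW) v (UnitaryGroup.finPart (Fp L) L (IsCMField.complexConj L) (n + n) (hermD L eV dV hdV dW hdW) (blkD L eV eA eB dA hdA dB hdB dV hdV hVA hVB dW hdW (1, y) * g))))
    (finite_mulSupport_lambdaLoc_total L eV dV hdV dW hdW χ hχ (s' - (n₁ : ℂ) / 2) _) hTT'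
  -- the tail: spherical components `Λ^{(V₂)}_{s',v}(y_v)` on the nose
  have htail : (∏ᶠ v : {v : HeightOneSpectrum (𝓞 (Fp L)) // v ∉ T'},
      LambdaLoc L eV dV hdV dW hdW v.1 χ (s' - (n₁ : ℂ) / 2) (UnitaryGroup.evalPlace (Fp L) L (IsCMField.complexConj L) (n + n) (hermD L eV dV hdV dW hdW) v.1 (UnitaryGroup.finPart (Fp L) L (IsCMField.complexConj L) (n + n) (hermD L eV dV hdV dW hdW) (blkD L eV eA eB dA hdA dB hdB dV hdV hVA hVB dW hdW (1, y) * g)))) =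
      ∏ᶠ v : {v : HeightOneSpectrum (𝓞 (Fp L)) // v ∉ T'},
        LambdaLoc L eB dB hdB dW hdW v.1 χ s' (UnitaryGroup.evalPlace (Fp L) L (IsCMField.complexConj L) (n₂ + n₂) (hermD L eB dB hdB dW hdW) v.1 (UnitaryGroup.finPart (Fp L) L (IsCMField.complexConj L) (n₂ + n₂) (hermD L eB dB hdB dW hdW) y)) := by
    refine finprod_congr fun v => ?_
    obtain ⟨⟨p, k₁⟩, hpk⟩ := hIw v.1 v.2 (UnitaryGroup.evalPlace (Fp L) L (IsCMField.complexConj L) (n₂ + n₂) (hermD L eB dB hdB dW hdW) v.1 (UnitaryGroup.finPart (Fp L) L (IsCMField.complexConj L) (n₂ + n₂) (hermD L eB dB hdB dW hdW) y))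
    rw [lambdaLoc_evalPlace_blkD_inr_mul L eV eA eB dA hdA dB hdB dV hdV hVA hVB dW hdW v.1 χ (s' - (n₁ : ℂ) / 2) (hχT v.1 v.2) y hpk (hg v.1 v.2), sub_add_cancel]
  -- the `T' ∖ T` factors
  have hmid : (∏ v ∈ T' \ T, LambdaLoc L eV dV hdV dW hdW v χ (s' - (n₁ : ℂ) / 2) (UnitaryGroup.evalPlace (Fp L) L (IsCMField.complexConj L) (n + n) (hermD L eV dV hdV dW hdW) v (UnitaryGroup.finPart (Fp L) L (IsCMField.complexConj L) (n + n) (hermD L eV dV hdV dW hdW) (blkD L eV eA eB dA hdA dB hdB dV hdV hVA hVB dW hdW (1, y) * g)))) =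
      ∏ v ∈ T' \ T, LambdaLoc L eV dV hdV dW hdW v χ (s' - (n₁ : ℂ) / 2)
        (if hv : v ∈ T' then UnitaryGroup.evalPlace (Fp L) L (IsCMField.complexConj L) (n + n) (hermD L eV dV hdV dW hdW) v (UnitaryGroup.finPart (Fp L) L (IsCMField.complexConj L) (n + n) (hermD L eV dV hdV dW hdW) (blkD L eV eA eB dA hdA dB hdB dV hdV hVA hVB dW hdW (1, locToAdelic L eB dB hdB dW hdW v (UnitaryGroup.evalPlace (Fp L) L (IsCMField.complexConj L) (n₂ + n₂) (hermD L eB dB hdB dW hdW) v (UnitaryGroup.finPart (Fp L) L (IsCMField.complexConj L) (n₂ + n₂) (hermD L eB dB hdB dW hdW) y))))) * UnitaryGroup.evalPlace (Fp L) L (IsCMField.complexConj L) (n + n) (hermD L eV dV hdV dW hdW) v (UnitaryGroup.finPart (Fp L) L (IsCMField.complexConj L) (n + n) (hermD L eV dV hdV dW hdW) g) else 1) := by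
    refine Finset.prod_congr rfl fun v hv => ?_
    rw [dif_pos (Finset.mem_sdiff.1 hv).1, hX]
  show f (s' - (n₁ : ℂ) / 2) (blkD L eV eA eB dA hdA dB hdB dV hdV hVA hVB dW hdW (1, y) * g) = _
  rw [hf (s' - (n₁ : ℂ) / 2) (blkD L eV eA eB dA hdA dB hdB dV hdV hVA hVB dW hdW (1, y) * g), hsplit, htail, hmid, harch, ← mul_assoc]
  simp only [hX]

end Summit.HodgeConjecture.HodgeConjecture.Cruxes.HLiu418.K2LiuKindOneLineFactorizable

end
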